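import Literature.Claims.NS.Ruzmaikina2008
import Literature.Analysis.FluidPDE.ClassicalNSHorizonPatching
import Literature.Analysis.FluidPDE.ClassicalNSBlowupAlternative
import Literature.Analysis.FluidPDE.NSTaoClassOfSobolevDatum
import Literature.Analysis.FluidPDE.ClassicalNSFiniteEnergyEquality
import HarnessLib

/-!
# Claim skeleton: Durmagambetov–Fazilova (2015), «Navier-Stokes Equations—Millennium Prize Problems»
# (Natural Science 7 (2015) no. 2, 88–99)

Cell `ns-claims` (D-0090 NS-CLAIMS SWEEP), claim C30, typist `ns-claims-typist-3` (g2).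
UNREFEREED/DISPUTED CLAIM under adjudication — NOTHING in this file asserts a step: every `Step…`
declaration is a `Prop`; the only `theorem`s are the kernel composition `claim_of_steps` (pure logic +
the tree's uniqueness theorem in the class), the Clay link modulo the classical patching delta, and
unfolding lemmas. Refutations go summit-side (`Theorems/SoloRefuteDurmagambetov2015.lean`).

Version of record (pinned by ns-claims-lit-1, `pub/ns-claims/sources/Durmagambetov2015/LOCATORS.md`):
A. A. Durmagambetov, L. S. Fazilova, Natural Science 7 (2015) 88–99, doi:10.4236/ns.2015.72010
[DurmagambetovFazilova2015NSMillennium]; PRINT PAGES 88–99 (renders `NaturalScience2015/pages/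
ns2015_pNNN.png`, print page = PDF page + 87; formulas read on the renders). Lineage (CARD §1):
arXiv 1510.07235 v1–v8 (2015–18, a different proof of the main theorem by an ε-rescaling chain),
arXiv 1605.06018 / EJPAM 2017, 2018 restatements — not typed here.

## Claimed statement (as printed, p.97)

«THEOREM 6. Let q₀ ∈ W²₂(R³), ∇²q̃₀ ∈ L₂(R³), f ∈ L₂(Q_T), f̃ ∈ L₁(Q_T) ∩ L₂(R³), ∇²f̃ ∈ L₁(Q_T) ∩
L₂(R³) and max_k‖Qq₀‖_{L₂} ≤ const, max_k‖Qf‖_{L₂} ≤ const, max_k‖Q_E q₀‖_{L₂} ≤ const,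
max_k‖Q_E f‖_{L₂} ≤ const. Then, there exists a unique generalized solution of (34), (35), (36)
satisfying the following inequality: max_t Σ_{i=1}^3 max_x |q_i| ≤ const, where the value of const
depends only on the conditions of the theorem.» ((34)–(36) p.93: `q_t − νΔq + (q,∇q) = −∇p + f(x,t)`,
`div q = 0`, `q|_{t=0} = q₀(x)` in `Q_T = R³ × (0,T)`, `div q₀ = 0`; «generalized solution» = the class
of Theorem 5 p.93 [Ladyzhenskaya]: `q_t, ∇²q, ∇p ∈ L₂(Q_T)`.) p.97 last line: «Theorem 6 asserts the
global solvability and uniqueness of the Cauchy problem for the Navier-Stokes equations.» Abstract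
p.88: «we present final solving Millennium Prize Problems formulated by Clay Math. Inst., Cambridge».

TYPED (`ClaimedTheorem`): the UNFORCED instance `f ≡ 0` (the one bearing on Clay (A); the forced
statement is printed — TODO(general form)), data in the Clay class (4) = `IsDatum30` (smooth,
divergence free, every derivative in `L²`, AND rapidly decaying — every such `q₀` satisfies the printed
hypotheses: `W²₂`, `∇²q̃₀ ∈ L₂` ⟺ `|x|²q₀ ∈ L₂`, finite shell norms of a Schwartz transform), solutions
RENDERED in the tree's classical Sobolev class `Ruzmaikina2008.IsSolution` (classical on
`ℝ³ × [0,T]`, all `L²` Sobolev norms bounded — contains the smooth generalized solutions of Theorem 5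
for such data; same rendering as C25 `Ruzmaikina2008`, whose vocabulary this file REUSES, not
restates): for every `ν > 0` and datum there is ONE constant `C` such that for every `T > 0` a
solution on `[0,T]` exists, is unique, and every solution obeys `Σ_i |q_i(x,t)| ≤ C` on `[0,T] × ℝ³`
(«const depends only on the conditions of the theorem»: with `f ≡ 0` no `T` is among them — the
T-UNIFORM reading; the referee's T-DEPENDENT reading «const = const(T, data, ν)», the conditions of the
forced theorem naming `Q_T`, is `ClaimedTheoremT`, WEAKER, `claimedT_of_claimed`; both compose:
`claim_of_steps`, `claimT_of_steps`). rev 2 (same day, before any refuter/referee kernel file imports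
this module): data class `IsDatum30` (adds Clay's decay (4), so that Lemma 21's weighted data
hypotheses hold — referee lane 2 (P2)/(3)), `ClaimedTheoremT`/`SmallnessT`/`Step2T`/`Step7T` (the
T-dependent readings, (P1)/(P3)/(P6)), `Statement3` p.97 in the proof's form with its positivity
hypothesis ((P5)), Clay link re-proved for the decaying class (`ClayDelta30`,
`clayA_of_claimed_of_delta`).

## Clay delta (reference `ClayVariants.lean`)

Nearest (A) `ClayVariants.clayR3.Regularity`. Δ1 «=» ℝ³ · Δ3 «=» (f ≡ 0 instance of a forced claim) ·
Δ4: printed data class W²₂ + `|x|²q₀ ∈ L₂` + Fourier-side shell hypotheses ⊇ Clay data — typed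
ON the Clay class `IsDatum30` (a restriction of the claim; no delta against (A)) · Δ5: «generalized solution» + sup-norm bound,
rendered classical-Sobolev — the sup bound makes the generalized solution smooth (LPS class
`L^∞_t L^∞_x`), standard · Δ6/Δ7: per-horizon existence «for (0,T)», uniqueness ⇒ ONE global solution:
the classical patching statement `ClayDelta30` (C25's `Ruzmaikina2008.ClayDelta` on the decaying
data class; pure bookkeeping, not a wrong-problem axis) — `clayA_of_claimed_of_delta : ClayDelta30 →
ClaimedTheoremT → clayR3.Regularity` PROVED (C25's argument: patched global solution, energy bound
by `bkm_energy_le`), hence also from `ClaimedTheorem`. The claim as typed is (A)-strength (indeed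
STRONGER: a time-uniform sup bound).

## Steps, in the dependency order of the PROOF OF THEOREM 6 (p.97, eight lines)

«Proof. It suffices to obtain uniform estimates of the maximum velocity components q_i, which
obviously follow from max_x|q_i|, because uniform estimates allow us to extend the local existence and
uniqueness theorem over the interval in which they are valid. To estimate the velocity components,
Lemma 22 can be used: v_i = q_i/(∫₀ᵀ‖q_x‖²_{L₂}dt + A₀ + 1), A₀ = 4/(ν^{1/3}(CC₀+1)^{2/3}). Using Lemmas
(25)–(29) for v_i … we can obtain ‖A_i‖_{TA} < α < 1 where A_i is the amplitude of potential v_i, and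
N(v_i) < 1. That is, discrete solutions are not significant in proving the theorem, so its assertion
follows the conditions of Theorem 6, which defines uniform time estimations for the maximum values of
the velocity components.» The only printed route from «‖A_i‖_TA < α, N(v_i) < 1» to a bound on the
VALUES of the potential v_i is §2's reconstruction block, Lemmas 13–17 (24)–(33) pp.92–93 (p.89: «we
study the inverse scattering problem, resulting in a formula for the scattering potential … with the
use of this potential, we obtain uniform time estimates»; «In the absence of a discrete spectrum, we
obtain estimations for the maximum potential»), whose pointwise output is (33).

* Step 1 = `Step1_localExistence` — Theorem 5 p.93 [17] (local unique generalized solution on `[0,T₁]`,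
  `T₁ = T₁(q₀, f)`), rendered in the class — classical (Kato; Majda–Bertozzi Thm 3.4).
* Step 2 = `Step2_continuation` — proof of Thm 6, sentence 1 p.97 («uniform estimates allow us to
  extend the local existence and uniqueness theorem») — classical (an `L^∞_{t,x}` a-priori bound is a
  Ladyzhenskaya–Prodi–Serrin class; continuation in the Sobolev class).
* Step 3 = `Step3_energy39` — Lemma 18 (39) p.93, typed with the factor `2ν` of the energy identity (the
  printed display «sup‖q‖² + ∫₀ᵗ‖∇q‖² ≤ ‖q₀‖² + ‖f‖» omits `ν` — one-token charity, recorded; cf. (52)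
  where `ν` is carried) — true (energy equality in the class; tree `bkm_energy_le` for the first term);
  **PROVED** (rev 3): `step3_energy39_holds`, by the tree's
  `IsClassicalNSSolutionOn.integral_norm_sq_add_dissipation_eq` (Leray's energy equality for
  finite-energy classical solutions, real form); `claim_of_steps''` composes Steps 1, 4–8 only.
* Step 4 = `Step4_fourierSup48` — Lemma 22 (48) p.94 «max_k|q̃| ≤ max_k|q̃₀| + (T/2) sup‖q‖² +
  ∫₀ᵗ‖∇q‖²dτ» (`f ≡ 0` instance; NB the printed (48) has no force term although (34) carries `f` —
  erratum candidate for the forced statement, immaterial here) — plausible/true (Duhamel + `|((q·∇)q)~|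
  ≤ ‖q‖‖∇q‖`).
* Step 5 = `Step5_moments46` — Lemma 21 (46) p.94 «∫|x|²|q|²dx + ∫₀ᵗ∫|x|²|∇q|²dxdτ ≤ const,
  ∫|x|⁴|q|² + ∫₀ᵗ∫|x|⁴|∇q|² ≤ const» («Proof this follows from the a priory estimation of Lemma18,
  conditions of Lemma 19, the Navier-Stokes equations» — one line), per-solution constant (the weak
  reading; the data-uniform reading is `Step5u_moments46_uniform`, not consumed) — unproved in print;
  plausible (weighted estimates need the pressure; He–Xin/Schonbek-type results give const(T)).
* Step 6 = `Step6_shellBound55` — Lemma 28 (55) p.96 «|NQq| ≤ C, |TNQq| ≤ C, |Qq| ≤ C, |TQq| ≤ C, … where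
  C = const» (no proof printed), typed for the functional (33) consumes: the Hilbert transform in the
  energy variable of the shell transform `Qq(z; e, e') = q̃(z(e − e'))` AT `|k| = 0`, for the solution's
  component slices — unproved; plausible.
* `Statement3` — p.97, before Theorem 6: «K = ν^{1/2}/(ν^{1/2} − 4πCC₀^{1/2}) … Statement 3. Let A =
  4/(ν^{1/3}(CC₀+1)^{2/3}), then K ≤ 8/7. Proof. … K = ν^{1/2}(ν^{1/2} − 4πCC₀/A^{3/2})^{−1} < 8/7»,
  typed in the PROOF's form with the positivity of the denominator as a hypothesis (referee lane 2
  (P5): without it «K ≤ 8/7» holds by sign junk) — known-false pattern as arithmetic (A^{3/2} =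
  8/(ν^{1/2}(CC₀+1)) ⇒ K = 1/(1 − (π/2)CC₀(CC₀+1)); CC₀ = 1/5 gives K ≈ 1.6 > 8/7). CONSUMED BY THE
  PROOF OF THM 6? The proof names the SAME constant `A₀ = 4/(ν^{1/3}(CC₀+1)^{2/3})` in the normalisation
  but attributes the smallness «‖A_i‖_TA < α < 1» to «Lemmas (25)–(29)» and never cites Statement 3 or
  `K`; typed as an on-path CANDIDATE in print order (between Step 6 and Step 7), the consumed/aside
  decision is the referee's; NOT a hypothesis of `claim_of_steps` (its content is absorbed in `∃ M`).
* Step 7 = `Step7_smallness` — proof of Thm 6 sentences 2–3 p.97 (the normalisation `v_i = q_i/M` and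
  «Using Lemmas (25)–(29) … ‖A_i‖_TA < α < 1 … N(v_i) < 1»), RENDERED AT THE GRAIN (33) CONSUMES — the
  INFERENCE from Steps 3–6 to: for every `ν`, datum and series constant `C₀`, a normalisation `M ≥ 1`
  depending on the data only, an `α < 1` and a bound `B` with `C₀B < 1` such that every translated,
  normalised component slice `v = q_i(· + a, t)/M` of every solution is an admissible potential with
  `‖v‖₂ + max_k|ṽ| < α` (Lemma 17's hypothesis) and `|TQv|_{|k|=0} ≤ B`. Typed as an implication
  `AprioriBlock → Smallness` (the amplitude `A_i` and the eigenvalue count `N(v_i)` are not typed —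
  TODO: Lemmas 3–15 vocabulary); suspicious («we can obtain», no derivation).
* Step 8 = `Step8_reconstruction33` — LEMMA 17 with (33), p.92–93: «Let q ∈ ℜ ∩ L₂(R³) and ‖q‖_{L₂} +
  max_k|q̃| < α < 1. Then … (33) |q||_{x=0} ≤ Σ_{i=1}^∞ (C₀|TQq||_{|k|=0})^i» — NS-free, typed at the
  abstract grain (HYGIENE 13) on the subclass of smooth `L¹ ∩ L²` potentials (⊂ ℜ ∩ L₂), with the
  printed `max_k|q̃|` and `|TQq|_{|k|=0}` replaced by upper bounds `S`, `B` (equivalent by monotonicity)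
  — KNOWN-FALSE pattern: for an EVEN potential (q(−x) = q(x)) the transform `q̃` is even, so the
  principal value `TQq|_{|k|=0} = (2πi)⁻¹ p.v.∫ q̃(s(e−e'))/s ds` vanishes for every direction pair and
  (33) forces q(0) = 0; a small even non-negative bump has `‖q‖₂ + max|q̃| ≤ a(‖ψ‖₂ + ‖ψ‖₁) < α` and
  `q(0) = a > 0`.
Ordered index (TYPING-HYGIENE 11): 1 → 2 → 3 → 4 → 5 → 6 → [Statement 3] → 7 → 8; `claim_of_steps`
consumes 1–8 (3–6 through 7's antecedent); the T-dependent variants `Step2T_continuation`,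
`Step7T_smallness` compose to `ClaimedTheoremT` (`claimT_of_steps`). Not typed as steps: §2 Lemmas 1–16 and (24)–(32) (the reconstruction
machinery behind (33); their output is Step 8), Lemmas 19, 20, 23, 24, 26, 27 (shell estimates feeding
Step 7's antecedent — represented by Steps 4–6; TODO on request), Statement 3 / the constants `K, A,
A₀` p.97 (absorbed in `∃ M`), Lemma 25 = (31) = (56) `∫∫q(x)q(y)/|x−y|² ≤ C(‖q‖₂ + max|q̃|)²` (true by
Plancherel; feeds N(v_i) < 1, not typed), (57), Theorem 7 p.98 («loss of smoothness», not the headline),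
the «large scale transformations» `t′ = tA, v′ = v/A, F₀′ = F₀/A²` p.97 (only their output `A₀` and
Statement 3 are typed).

## COMPOSITION — PROVED

`claim_of_steps : Step1 → Step2 → Step3 → Step4 → Step5 → Step6 → Step7 → Step8 → ClaimedTheorem`:
Step 7 (fed 3–6) + Step 8 at every translate give `|q_i(a,t)| ≤ M·C₀B/(1 − C₀B)` for every solution
on every `[0,T]`, a data-only constant; Step 2 (fed Step 1 and this bound) gives existence on every
`[0,T]`; uniqueness is the tree's `IsClassicalNSSolutionOn.eq_of_hasBoundedSobolevNormsOn`.
`claimT_of_steps : Step1 → Step2T → Step3 → Step4 → Step5 → Step6 → Step7T → Step8 → ClaimedTheoremT`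
likewise; `clayA_of_claimed_of_delta` PROVED. An ALL-STEPS-RESIST outcome would be an escalation
((A)-strength).

WHAT THIS IS NOT: not a claim about NS regularity or blow-up; not a claim about any author beyond the
typed locator.
-/

noncomputable section

open Set Function Filter MeasureTheory
open scoped Topology ENNReal NNReal ContDiff

namespace Literature.Claims.NS.Durmagambetov2015

open Literature.Analysis.FluidPDE
open Literature.Claims.NS.Ruzmaikina2008 (IsDatum IsSolutionOn IsSolution IsGlobalSolution)

/-! ## Vocabulary of the paper (definitions with bodies; nothing asserted) -/

/-- The paper's Fourier transform of a scalar potential, p.92: `q̃(k) = ∫_{R³} q(x) e^{i(k,x)} dx`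
(no `2π`, sign `+`; for the moduli `|q̃(k)|` used below any convention gives the same set of values).
Bochner integral: meaningful for `q ∈ L¹` (carried as a hypothesis where needed, `IsPotential`).
[cite: DurmagambetovFazilova2015NSMillennium, p.92 (notation before (26))] -/
def ft (q : EuclideanSpace ℝ (Fin 3) → ℝ) (k : EuclideanSpace ℝ (Fin 3)) : ℂ :=
  ∫ x, (q x : ℂ) * Complex.exp (Complex.I * ((inner ℝ k x : ℝ) : ℂ))

/-- The `L₂(R³)` norm of a scalar potential. [cite: DurmagambetovFazilova2015NSMillennium, Lemma 17 p.92] -/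
def l2 (q : EuclideanSpace ℝ (Fin 3) → ℝ) : ℝ :=
  Real.sqrt (∫ x, q x ^ 2)

/-- **`TQq` at `|k| = 0`.** The shell transform is `Qq = ∫ q(x)e^{i(k−l,x)}dx = q̃(k − l)` (p.92), read
on the energy shell `k = z·e`, `l = z·e'` (p.95: `|Qq(z,t)| ≤ (z/2)∫∫|q̃(z(e_k − e_p),t)|de_p`), i.e.
`z ↦ q̃(z(e − e'))`; `T = ½(T₊ + T₋)` ((10)–(11) p.90, boundary values of the Cauchy integral
`(2πi)⁻¹∫ f(s)/(s − z) ds`, so that `T± = T ± ½I` (12)) is the principal-value Hilbert-type transform in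
the energy variable. At `z = |k| = 0`: `(TQq)(0; e, e') = (2πi)⁻¹ p.v.∫_{−∞}^{∞} q̃(s(e − e'))/s ds =
(2πi)⁻¹ ∫₀^∞ (q̃(sd) − q̃(−sd))/s ds`, `d = e − e'` (the symmetric form of the principal value, equal
to the printed limit for the smooth decaying functions at hand). Argument `d` = the difference of the
two directions (`‖d‖ ≤ 2`). [cite: DurmagambetovFazilova2015NSMillennium, (10)–(12) p.90, p.92, (33) p.93] -/
def tq0 (q : EuclideanSpace ℝ (Fin 3) → ℝ) (d : EuclideanSpace ℝ (Fin 3)) : ℂ :=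
  (1 / (2 * Real.pi * Complex.I)) *
    ∫ s in Ioi (0 : ℝ), (ft q (s • d) - ft q ((-s) • d)) / (s : ℂ)

/-- Admissible scattering potentials for the typed Lemma 17: smooth real functions in `L¹ ∩ L²(R³)` (so
`q̃` is a genuine bounded continuous function and `q` is in the Rollnik class `ℜ` of Definition 1 p.89,
`∫∫|q(x)q(y)|/|x−y|² ≤ C‖q‖²_{3/2} < ∞`): a SUBCLASS of the printed `ℜ ∩ L₂(R³)`.
[cite: DurmagambetovFazilova2015NSMillennium, Definition 1 p.89 and Lemma 17 p.92] -/
def IsPotential (q : EuclideanSpace ℝ (Fin 3) → ℝ) : Prop :=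
  ContDiff ℝ ∞ q ∧ Integrable q ∧ Integrable fun x => q x ^ 2

/-- `‖q(·,t)‖²_{L₂(R³)}` of a velocity field. [cite: DurmagambetovFazilova2015NSMillennium, (39) p.93] -/
def energy (u : ℝ → EuclideanSpace ℝ (Fin 3) → EuclideanSpace ℝ (Fin 3)) (t : ℝ) : ℝ :=
  ∫ x, ‖u t x‖ ^ 2

/-- `∫₀ᵗ ‖q_x‖²_{L₂(R³)} dτ` (the dissipation integral in (39), (48) and in the normalisation of p.97),
`‖q_x‖² = Σ_{i,j}|∂_j q_i|²` = Frobenius norm of `Dq`. [cite: DurmagambetovFazilova2015NSMillennium, (39) p.93 and proof of Thm 6 p.97] -/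
def dissipation (u : ℝ → EuclideanSpace ℝ (Fin 3) → EuclideanSpace ℝ (Fin 3)) (t : ℝ) : ℝ :=
  ∫ s in (0 : ℝ)..t, ∫ x, frobeniusNormSq (fderiv ℝ (u s) x)

/-- The `i`-th component slice of a velocity field at time `t`, translated by `a`:
`x ↦ q_i(x + a, t)` (the scattering potential of p.97 is a velocity component; (33) bounds its value
at `x = 0`, so every base point `a` is reached by translation).
[cite: DurmagambetovFazilova2015NSMillennium, proof of Thm 6 p.97 «A_i is the amplitude of potential v_i»] -/
def slice (u : ℝ → EuclideanSpace ℝ (Fin 3) → EuclideanSpace ℝ (Fin 3)) (t : ℝ) (i : Fin 3)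
    (a : EuclideanSpace ℝ (Fin 3)) : EuclideanSpace ℝ (Fin 3) → ℝ :=
  fun x => u t (x + a) i

/-- The translated component slice at the base point is the component value (unfolding). [cite: DurmagambetovFazilova2015NSMillennium, proof of Thm 6 p.97] -/
@[simp] theorem slice_zero (u : ℝ → EuclideanSpace ℝ (Fin 3) → EuclideanSpace ℝ (Fin 3)) (t : ℝ)
    (i : Fin 3) (a : EuclideanSpace ℝ (Fin 3)) : slice u t i a 0 = u t a i := by
  simp [slice]

/-- **The data class of the typed Theorem 6 = Clay (A)'s data**: C25's rendered class `IsDatum`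
(smooth, divergence free, every derivative in `L²(R³)`) AND Fefferman's rapid decay (4) — so that the
printed hypotheses of Theorem 6 / Lemmas 20–21 hold: `q₀ ∈ W²₂(R³)`, `∇²q̃₀ ∈ L₂` (⟺ `|x|²q₀ ∈ L₂`),
`max_k‖Qq₀‖_{L₂}, max_k‖Q_E q₀‖_{L₂} ≤ const` (shell norms of a Schwartz transform). TODO(general form):
the printed W²₂ class. [cite: DurmagambetovFazilova2015NSMillennium, Theorem 6 hypotheses p.97; Lemma 21 p.94] -/
def IsDatum30 (q₀ : EuclideanSpace ℝ (Fin 3) → EuclideanSpace ℝ (Fin 3)) : Prop :=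
  IsDatum q₀ ∧ HasRapidSpatialDecay q₀

/-- Clay data (smooth, divergence free, rapid decay (4)) are data of the class (Schwartz ⇒ `H^∞`, tree
`HasRapidSpatialDecay.lintegral_enorm_iteratedFDeriv_sq_lt_top`). [cite: FeffermanClay2006, (A) with (4), CMI offprint p. 2] -/
theorem isDatum30_of_clay {q₀ : EuclideanSpace ℝ (Fin 3) → EuclideanSpace ℝ (Fin 3)}
    (h : ContDiff ℝ ∞ q₀) (hdiv : NSWave0.IsDivFree q₀) (hdec : HasRapidSpatialDecay q₀) : IsDatum30 q₀ :=
  ⟨⟨h, fun x => hdiv x, fun n => hdec.lintegral_enorm_iteratedFDeriv_sq_lt_top n⟩, hdec⟩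

/-! ## The claimed statement (Theorem 6 p.97, unforced instance, rendered class) -/

/-- **THEOREM 6 (p.97), `f ≡ 0`, data in the Clay class, solutions in the classical Sobolev class**:
for every `ν > 0` and datum `q₀` there is a constant `C` depending only on `(ν, q₀)` such that for every
`T > 0`: a solution on `[0,T]` exists («there exists»), any two coincide («unique»), and every solution
satisfies `Σ_{i=1}^3 |q_i(x,t)| ≤ C` on `[0,T] × R³` («max_t Σ_i max_x |q_i| ≤ const, where the value
of const depends only on the conditions of the theorem»).
[cite: DurmagambetovFazilova2015NSMillennium, Theorem 6 p.97] -/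
def ClaimedTheorem : Prop :=
  ∀ ν : ℝ, 0 < ν → ∀ q₀ : EuclideanSpace ℝ (Fin 3) → EuclideanSpace ℝ (Fin 3), IsDatum30 q₀ →
    ∃ C : ℝ, ∀ T : ℝ, 0 < T →
      (∃ (u : ℝ → EuclideanSpace ℝ (Fin 3) → EuclideanSpace ℝ (Fin 3))
          (p : ℝ → EuclideanSpace ℝ (Fin 3) → ℝ), IsSolution ν T q₀ u p) ∧
      (∀ (u : ℝ → EuclideanSpace ℝ (Fin 3) → EuclideanSpace ℝ (Fin 3)) (p : ℝ → EuclideanSpace ℝ (Fin 3) → ℝ)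
          (u' : ℝ → EuclideanSpace ℝ (Fin 3) → EuclideanSpace ℝ (Fin 3))
          (p' : ℝ → EuclideanSpace ℝ (Fin 3) → ℝ),
          IsSolution ν T q₀ u p → IsSolution ν T q₀ u' p' → ∀ t ∈ Icc 0 T, u' t = u t) ∧
      ∀ (u : ℝ → EuclideanSpace ℝ (Fin 3) → EuclideanSpace ℝ (Fin 3)) (p : ℝ → EuclideanSpace ℝ (Fin 3) → ℝ),
        IsSolution ν T q₀ u p → ∀ t ∈ Icc 0 T, ∀ x, ∑ i : Fin 3, |u t x i| ≤ C

/-- **THEOREM 6, T-DEPENDENT reading (referee lane 2, (P3)/(P6))**: as `ClaimedTheorem` but with the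
constant allowed to depend on the horizon, `const = const(T, ν, q₀)` («the conditions of the theorem»
include `Q_T` in the forced statement; Lemma 22 (48) carries `T/2`). WEAKER than `ClaimedTheorem`
(`claimedT_of_claimed`); still (A)-strength with `ClayDelta30`.
[cite: DurmagambetovFazilova2015NSMillennium, Theorem 6 p.97] -/
def ClaimedTheoremT : Prop :=
  ∀ ν : ℝ, 0 < ν → ∀ q₀ : EuclideanSpace ℝ (Fin 3) → EuclideanSpace ℝ (Fin 3), IsDatum30 q₀ →
    ∀ T : ℝ, 0 < T → ∃ C : ℝ,
      (∃ (u : ℝ → EuclideanSpace ℝ (Fin 3) → EuclideanSpace ℝ (Fin 3))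
          (p : ℝ → EuclideanSpace ℝ (Fin 3) → ℝ), IsSolution ν T q₀ u p) ∧
      (∀ (u : ℝ → EuclideanSpace ℝ (Fin 3) → EuclideanSpace ℝ (Fin 3)) (p : ℝ → EuclideanSpace ℝ (Fin 3) → ℝ)
          (u' : ℝ → EuclideanSpace ℝ (Fin 3) → EuclideanSpace ℝ (Fin 3))
          (p' : ℝ → EuclideanSpace ℝ (Fin 3) → ℝ),
          IsSolution ν T q₀ u p → IsSolution ν T q₀ u' p' → ∀ t ∈ Icc 0 T, u' t = u t) ∧
      ∀ (u : ℝ → EuclideanSpace ℝ (Fin 3) → EuclideanSpace ℝ (Fin 3)) (p : ℝ → EuclideanSpace ℝ (Fin 3) → ℝ),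
        IsSolution ν T q₀ u p → ∀ t ∈ Icc 0 T, ∀ x, ∑ i : Fin 3, |u t x i| ≤ C

/-- The T-uniform reading implies the T-dependent one. [cite: DurmagambetovFazilova2015NSMillennium, Theorem 6 p.97] -/
theorem claimedT_of_claimed (h : ClaimedTheorem) : ClaimedTheoremT := by
  intro ν hν q₀ hq₀ T hT
  obtain ⟨C, hC⟩ := h ν hν q₀ hq₀
  exact ⟨C, hC T hT⟩

/-- **`ClayDelta30`** (axis Δ6/Δ7, horizon bookkeeping; C25's `Ruzmaikina2008.ClayDelta` on the decaying
data class): per-horizon existence on every `[0,T]` plus uniqueness define ONE global solution in the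
class. Classical patching; not a «wrong problem» axis. [cite: FeffermanClay2006, statement (A)] -/
def ClayDelta30 : Prop :=
  ∀ ν : ℝ, 0 < ν → ∀ u₀ : EuclideanSpace ℝ (Fin 3) → EuclideanSpace ℝ (Fin 3), IsDatum30 u₀ →
    (∀ T : ℝ, 0 < T →
      ∃ (u : ℝ → EuclideanSpace ℝ (Fin 3) → EuclideanSpace ℝ (Fin 3)) (p : ℝ → EuclideanSpace ℝ (Fin 3) → ℝ),
        IsSolution ν T u₀ u p) →
    (∀ T : ℝ, 0 < T →
      ∀ (u : ℝ → EuclideanSpace ℝ (Fin 3) → EuclideanSpace ℝ (Fin 3)) (p : ℝ → EuclideanSpace ℝ (Fin 3) → ℝ)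
        (u' : ℝ → EuclideanSpace ℝ (Fin 3) → EuclideanSpace ℝ (Fin 3)) (p' : ℝ → EuclideanSpace ℝ (Fin 3) → ℝ),
        IsSolution ν T u₀ u p → IsSolution ν T u₀ u' p' → ∀ t ∈ Icc 0 T, u' t = u t) →
    ∃ (u : ℝ → EuclideanSpace ℝ (Fin 3) → EuclideanSpace ℝ (Fin 3)) (p : ℝ → EuclideanSpace ℝ (Fin 3) → ℝ),
      IsGlobalSolution ν u₀ u p

/-- **Clay link (HYGIENE 10(b))**: `ClayDelta30 → ClaimedTheoremT → clayR3.Regularity` (Clay (A),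
token-identical to the summit body). C25's argument (`Ruzmaikina2008.clay_of_claimed_of_delta`) on the
decaying class: a Clay datum is a datum of the class (`isDatum30_of_clay`); the patched global solution
is smooth on `ℝ³ × [0,∞)` with `u(0) = u₀` (`isNavierStokesSolution_and_smooth_iff`); the energy bound
(7) holds with `C = ∫|u₀|²` by `IsClassicalNSSolutionOn.bkm_energy_le`. Hence also
`ClaimedTheorem → …` via `claimedT_of_claimed`. [cite: FeffermanClay2006, statement (A), CMI offprint p. 2] -/
theorem clayA_of_claimed_of_delta (hΔ : ClayDelta30) (h : ClaimedTheoremT) :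
    ClayVariants.clayR3.Regularity := by
  intro ν hν u₀ hu₀ hdiv hdecay
  have hdat30 : IsDatum30 u₀ := isDatum30_of_clay hu₀ hdiv hdecay
  have hdat : IsDatum u₀ := hdat30.1
  obtain ⟨u, p, hsol⟩ :=
    hΔ ν hν u₀ hdat30 (fun T hT => (h ν hν u₀ hdat30 T hT).choose_spec.1)
      (fun T hT => (h ν hν u₀ hdat30 T hT).choose_spec.2.1)
  obtain ⟨hns, hsu, hsp⟩ :=
    (isNavierStokesSolution_and_smooth_iff (ν := ν) (f := 0) (u₀ := u₀) (u := u) (p := p)).2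
      ⟨hsol.isClassical, hsol.initial⟩
  refine ⟨u, p, hsu, hsp, hns, ?_⟩
  show HasBoundedEnergy u
  have key : ∀ S : ℝ, 0 < S → ∀ τ ∈ Icc (0:ℝ) S,
      ∫⁻ x, ‖u τ x‖ₑ ^ 2 = ENNReal.ofReal (∫ x, ‖u τ x‖ ^ 2) := by
    intro S hS τ hτ
    have hcl : IsClassicalNSSolutionOn (Icc 0 S) ν 0 u p :=
      hsol.isClassical.mono Icc_subset_Ici_self (uniqueDiffOn_Icc hS)
    obtain ⟨C, hC⟩ := hsol.sobolev S 0
    have hfin0 : ∫⁻ x, ‖iteratedFDeriv ℝ 0 (u τ) x‖ₑ ^ 2 < ⊤ := (hC τ hτ).trans_lt ENNReal.coe_lt_top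
    have heq : (fun x => ‖iteratedFDeriv ℝ 0 (u τ) x‖ₑ ^ 2) = fun x => ‖u τ x‖ₑ ^ 2 := by
      funext x
      rw [← ofReal_norm, norm_iteratedFDeriv_zero, ofReal_norm]
    have hfin : ∫⁻ x, ‖u τ x‖ₑ ^ 2 < ⊤ := by rwa [heq] at hfin0
    have hint : Integrable (fun x => ‖u τ x‖ ^ 2) :=
      integrable_sq_norm_of_lintegral_lt_top (hcl.contDiff_velocity hτ).continuous hfin
    rw [ofReal_integral_eq_lintegral_ofReal hint (Eventually.of_forall fun x => sq_nonneg _)]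
    refine lintegral_congr fun x => ?_
    rw [← ofReal_norm, ENNReal.ofReal_pow (norm_nonneg _)]
  refine ⟨∫⁻ x, ‖u₀ x‖ₑ ^ 2, ?_, fun t ht => ?_⟩
  · have h0 := hdat.2.2 0
    have heq : (fun x => ‖iteratedFDeriv ℝ 0 u₀ x‖ₑ ^ 2) = fun x => ‖u₀ x‖ₑ ^ 2 := by
      funext x
      rw [← ofReal_norm, norm_iteratedFDeriv_zero, ofReal_norm]
    rwa [heq] at h0
  · have hT : (0:ℝ) < t + 1 := by linarith
    have hcl : IsClassicalNSSolutionOn (Icc 0 (t + 1)) ν 0 u p :=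
      hsol.isClassical.mono Icc_subset_Ici_self (uniqueDiffOn_Icc hT)
    have hE : ∫ x, ‖u t x‖ ^ 2 ≤ ∫ x, ‖u 0 x‖ ^ 2 :=
      hcl.bkm_energy_le hν.le hT (hsol.sobolev (t + 1)) ⟨ht, by linarith⟩
    rw [key (t + 1) hT t ⟨ht, by linarith⟩, ← hsol.initial, key (t + 1) hT 0 ⟨le_rfl, hT.le⟩]
    exact ENNReal.ofReal_le_ofReal hE

/-! ## The steps -/

/-- **Step 1 — Theorem 5 p.93 («The following results have been proved [17]: If q₀ ∈ W¹₂(R³), f ∈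
L₂(Q_T), there is a single generalized solution of (34), (35), (36) in the domain Q_{T₁}, T₁ ∈ [0,T],
satisfying q_t, ∇²q, ∇p ∈ L₂(Q_T). Note that T₁ depends on q₀ and f»)**, rendered (f ≡ 0, Clay data,
classical Sobolev class): a local solution exists on some `[0,T₁]`, `T₁ > 0`. Classical (Kato 1984 /
Majda–Bertozzi Thm 3.4; uniqueness in the class is the tree's
`IsClassicalNSSolutionOn.eq_of_hasBoundedSobolevNormsOn`). [cite: DurmagambetovFazilova2015NSMillennium, Theorem 5 (37)–(38) p.93] -/
def Step1_localExistence : Prop :=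
  ∀ ν : ℝ, 0 < ν → ∀ q₀ : EuclideanSpace ℝ (Fin 3) → EuclideanSpace ℝ (Fin 3), IsDatum30 q₀ →
    ∃ T₁ : ℝ, 0 < T₁ ∧
      ∃ (u : ℝ → EuclideanSpace ℝ (Fin 3) → EuclideanSpace ℝ (Fin 3)) (p : ℝ → EuclideanSpace ℝ (Fin 3) → ℝ),
        IsSolution ν T₁ q₀ u p

/-- **Step 2 — proof of Theorem 6, first sentence p.97**: «It suffices to obtain uniform estimates of
the maximum velocity components q_i … because uniform estimates allow us to extend the local existence
and uniqueness theorem over the interval in which they are valid.» Typed: given local existence and ONE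
constant `C` bounding `Σ_i|q_i|` for every solution on every `[0,T]` with this datum, solutions exist on
every `[0,T]`. Classical (an a-priori `L^∞_{t,x}` bound is a Ladyzhenskaya–Prodi–Serrin class;
continuation in the Sobolev class). [cite: DurmagambetovFazilova2015NSMillennium, proof of Theorem 6 p.97 (sentence 1)] -/
def Step2_continuation : Prop :=
  ∀ ν : ℝ, 0 < ν → ∀ q₀ : EuclideanSpace ℝ (Fin 3) → EuclideanSpace ℝ (Fin 3), IsDatum30 q₀ →
    (∃ T₁ : ℝ, 0 < T₁ ∧
      ∃ (u : ℝ → EuclideanSpace ℝ (Fin 3) → EuclideanSpace ℝ (Fin 3)) (p : ℝ → EuclideanSpace ℝ (Fin 3) → ℝ),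
        IsSolution ν T₁ q₀ u p) →
    ∀ C : ℝ,
      (∀ T : ℝ, 0 < T →
        ∀ (u : ℝ → EuclideanSpace ℝ (Fin 3) → EuclideanSpace ℝ (Fin 3)) (p : ℝ → EuclideanSpace ℝ (Fin 3) → ℝ),
          IsSolution ν T q₀ u p → ∀ t ∈ Icc 0 T, ∀ x, ∑ i : Fin 3, |u t x i| ≤ C) →
      ∀ T : ℝ, 0 < T →
        ∃ (u : ℝ → EuclideanSpace ℝ (Fin 3) → EuclideanSpace ℝ (Fin 3)) (p : ℝ → EuclideanSpace ℝ (Fin 3) → ℝ),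
          IsSolution ν T q₀ u p

/-- **Step 2, T-DEPENDENT form** (the same printed sentence p.97, read with horizon-dependent bounds —
referee lane 2 (P3)/(P6)): given local existence and, for every horizon `T`, ONE constant `C_T`
bounding `Σ_i|q_i|` for every solution on every `[0,T']`, `T' ≤ T`, solutions exist on every `[0,T]`.
Classical. [cite: DurmagambetovFazilova2015NSMillennium, proof of Theorem 6 p.97 (sentence 1)] -/
def Step2T_continuation : Prop :=
  ∀ ν : ℝ, 0 < ν → ∀ q₀ : EuclideanSpace ℝ (Fin 3) → EuclideanSpace ℝ (Fin 3), IsDatum30 q₀ →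
    (∃ T₁ : ℝ, 0 < T₁ ∧
      ∃ (u : ℝ → EuclideanSpace ℝ (Fin 3) → EuclideanSpace ℝ (Fin 3)) (p : ℝ → EuclideanSpace ℝ (Fin 3) → ℝ),
        IsSolution ν T₁ q₀ u p) →
    (∀ T : ℝ, 0 < T → ∃ C : ℝ, ∀ T' : ℝ, 0 < T' → T' ≤ T →
        ∀ (u : ℝ → EuclideanSpace ℝ (Fin 3) → EuclideanSpace ℝ (Fin 3)) (p : ℝ → EuclideanSpace ℝ (Fin 3) → ℝ),
          IsSolution ν T' q₀ u p → ∀ t ∈ Icc 0 T', ∀ x, ∑ i : Fin 3, |u t x i| ≤ C) →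
      ∀ T : ℝ, 0 < T →
        ∃ (u : ℝ → EuclideanSpace ℝ (Fin 3) → EuclideanSpace ℝ (Fin 3)) (p : ℝ → EuclideanSpace ℝ (Fin 3) → ℝ),
          IsSolution ν T q₀ u p

/-- **Step 3 — Lemma 18, energy inequality (39) p.93**: printed «sup_{0≤t≤T}‖q‖²_{L₂(R³)} +
∫₀ᵗ‖∇q‖²_{L₂(R³)}dτ ≤ ‖q₀‖²_{L₂(R³)} + ‖f‖_{L₂(Q_T)}»; typed for `f ≡ 0` WITH the factor `2ν` the energy
identity carries (the display omits `ν`; cf. (52), (54) where `ν` appears — one-token charity, the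
ν-free reading being false for `ν < ½` by the energy equality itself): for every solution on `[0,T]` and
`t ∈ [0,T]`, `‖q(t)‖² + 2ν∫₀ᵗ‖q_x‖² ≤ ‖q₀‖²`. True in the class (tree `IsClassicalNSSolutionOn.bkm_energy_le`
for the first term). [cite: DurmagambetovFazilova2015NSMillennium, Lemma 18 (39) p.93] -/
def Step3_energy39 : Prop :=
  ∀ (ν T : ℝ) (q₀ : EuclideanSpace ℝ (Fin 3) → EuclideanSpace ℝ (Fin 3))
    (u : ℝ → EuclideanSpace ℝ (Fin 3) → EuclideanSpace ℝ (Fin 3)) (p : ℝ → EuclideanSpace ℝ (Fin 3) → ℝ),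
    0 < ν → 0 < T → IsDatum30 q₀ → IsSolution ν T q₀ u p →
      ∀ t ∈ Icc 0 T, energy u t + 2 * ν * dissipation u t ≤ energy u 0

/-- **Step 4 — Lemma 22 (48) p.94**: «The solution of (34), (35), (36) satisfies the following
inequalities: max_k|q̃| ≤ max_k|q̃₀| + (T/2) sup_{0≤t≤T}‖q‖²_{L₂(R³)} + ∫₀ᵗ‖∇q‖²_{L₂(R³)}dτ» («Proof this
follows from the a priory estimation of Lemma 18, conditions of Lemma 22, the Navier-Stokes
equations»), `f ≡ 0` instance (the printed display has no force term although (34) carries `f`),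
componentwise, with the printed maxima replaced by arbitrary upper bounds `S₀` (for `max_k|q̃₀|`) and
`E` (for the sup of the energy) — equivalent by monotonicity. Flag: plausible/true for `f ≡ 0`.
[cite: DurmagambetovFazilova2015NSMillennium, Lemma 22 (48) p.94] -/
def Step4_fourierSup48 : Prop :=
  ∀ (ν T : ℝ) (q₀ : EuclideanSpace ℝ (Fin 3) → EuclideanSpace ℝ (Fin 3))
    (u : ℝ → EuclideanSpace ℝ (Fin 3) → EuclideanSpace ℝ (Fin 3)) (p : ℝ → EuclideanSpace ℝ (Fin 3) → ℝ),
    0 < ν → 0 < T → IsDatum30 q₀ → IsSolution ν T q₀ u p →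
      ∀ S₀ E : ℝ, (∀ (i : Fin 3) (k : EuclideanSpace ℝ (Fin 3)), ‖ft (fun x => q₀ x i) k‖ ≤ S₀) →
        (∀ s ∈ Icc 0 T, energy u s ≤ E) →
          ∀ t ∈ Icc 0 T, ∀ (i : Fin 3) (k : EuclideanSpace ℝ (Fin 3)),
            ‖ft (fun x => u t x i) k‖ ≤ S₀ + T / 2 * E + dissipation u t

/-- **Step 5 — Lemma 21 (46) p.94 (weighted moments)**: «The solution of (34), (35), (36) in Theorem 5
satisfies the following inequalities: ∫_{R³}|x|²|q|²dx + ∫₀ᵗ∫_{R³}|x|²|∇q|²dxdτ ≤ const,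
∫_{R³}|x|⁴|q|²dx + ∫₀ᵗ∫_{R³}|x|⁴|∇q|²dxdτ ≤ const» ((47) = the same in Fourier variables, `∇_k q̃`),
«Proof this follows from the a priory estimation of Lemma18, conditions of Lemma 19, the
Navier-Stokes equations». Typed in the WEAK reading (a constant per solution and horizon), with lower
Lebesgue integrals (divergence = ⊤, no junk value). Flag: unproved in print (the energy inequality gives
no weighted bound without a pressure estimate); plausible with const(T). The uniform reading is
`Step5u_moments46_uniform`. [cite: DurmagambetovFazilova2015NSMillennium, Lemma 21 (46)–(47) p.94] -/
def Step5_moments46 : Prop :=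
  ∀ (ν T : ℝ) (q₀ : EuclideanSpace ℝ (Fin 3) → EuclideanSpace ℝ (Fin 3))
    (u : ℝ → EuclideanSpace ℝ (Fin 3) → EuclideanSpace ℝ (Fin 3)) (p : ℝ → EuclideanSpace ℝ (Fin 3) → ℝ),
    0 < ν → 0 < T → IsDatum30 q₀ → IsSolution ν T q₀ u p →
      ∃ C : ℝ≥0, ∀ t ∈ Icc 0 T, ∀ m ∈ ({2, 4} : Set ℕ),
        (∫⁻ x, ENNReal.ofReal (‖x‖ ^ m * ‖u t x‖ ^ 2)) +
            ∫⁻ s in Ioo 0 t, ∫⁻ x, ENNReal.ofReal (‖x‖ ^ m * frobeniusNormSq (fderiv ℝ (u s) x)) ≤ C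

/-- **Step 5u — Lemma 21 (46) p.94, UNIFORM reading** («≤ const» with a constant depending on the data
`(ν, q₀)` only, for all horizons). Not consumed by `claim_of_steps`; recorded for the referee
(TYPING-HYGIENE 4). [cite: DurmagambetovFazilova2015NSMillennium, Lemma 21 (46)–(47) p.94] -/
def Step5u_moments46_uniform : Prop :=
  ∀ (ν : ℝ) (q₀ : EuclideanSpace ℝ (Fin 3) → EuclideanSpace ℝ (Fin 3)), 0 < ν → IsDatum30 q₀ →
    ∃ C : ℝ≥0, ∀ T : ℝ, 0 < T →
      ∀ (u : ℝ → EuclideanSpace ℝ (Fin 3) → EuclideanSpace ℝ (Fin 3)) (p : ℝ → EuclideanSpace ℝ (Fin 3) → ℝ),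
        IsSolution ν T q₀ u p → ∀ t ∈ Icc 0 T, ∀ m ∈ ({2, 4} : Set ℕ),
          (∫⁻ x, ENNReal.ofReal (‖x‖ ^ m * ‖u t x‖ ^ 2)) +
              ∫⁻ s in Ioo 0 t, ∫⁻ x, ENNReal.ofReal (‖x‖ ^ m * frobeniusNormSq (fderiv ℝ (u s) x)) ≤ C

/-- **Step 6 — Lemma 28 (55) p.96**: «Weak solution of problem (34), (35), (36) from Theorem 5 satisfies
the following inequalities |NQq| ≤ C, |TNQq| ≤ C, |Qq| ≤ C, |TQq| ≤ C, |NQ_Eq| ≤ C, |TNQ_Eq| ≤ C,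
|Q_Eq| ≤ C, |TQ_Eq| ≤ C where C = const» (no proof printed), typed for the one functional that (33)
consumes — `|TQq|` at `|k| = 0` — of every component slice of the solution, every direction pair:
a constant per solution and horizon. Flag: unproved; plausible (finite for smooth decaying slices).
[cite: DurmagambetovFazilova2015NSMillennium, Lemma 28 (55) p.96] -/
def Step6_shellBound55 : Prop :=
  ∀ (ν T : ℝ) (q₀ : EuclideanSpace ℝ (Fin 3) → EuclideanSpace ℝ (Fin 3))
    (u : ℝ → EuclideanSpace ℝ (Fin 3) → EuclideanSpace ℝ (Fin 3)) (p : ℝ → EuclideanSpace ℝ (Fin 3) → ℝ),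
    0 < ν → 0 < T → IsDatum30 q₀ → IsSolution ν T q₀ u p →
      ∃ C : ℝ, ∀ t ∈ Icc 0 T, ∀ (i : Fin 3) (d : EuclideanSpace ℝ (Fin 3)), ‖d‖ ≤ 2 →
        ‖tq0 (fun x => u t x i) d‖ ≤ C

/-- The ANTECEDENT of the smallness inference of p.97: the a-priori block the proof names («Lemma 22
can be used», «Using Lemmas (25)–(29)», all resting on Lemma 18) — here Steps 3, 4, 5, 6.
[cite: DurmagambetovFazilova2015NSMillennium, proof of Theorem 6 p.97] -/
def AprioriBlock : Prop :=
  Step3_energy39 ∧ Step4_fourierSup48 ∧ Step5_moments46 ∧ Step6_shellBound55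

/-- The CONSEQUENT of the smallness inference of p.97, at the grain (33) consumes: for every `ν > 0`,
datum `q₀` and series constant `C₀ ≥ 0` there are a normalisation `M ≥ 1` (the paper's
`M = ∫₀ᵀ‖q_x‖²dt + A₀ + 1`, `A₀ = 4/(ν^{1/3}(CC₀ + 1)^{2/3})`, bounded by the data through (39) — typed
`∃ M`, weaker), a smallness level `α < 1` and a bound `B ≥ 0` with `C₀B < 1` (convergence of the series
(33)) such that for every solution on every `[0,T]`, every time, component and base point, the
normalised translated slice `v = q_i(· + a, t)/M` is an admissible potential with
`‖v‖_{L₂} + max_k|ṽ| < α` («‖A_i‖_TA < α < 1 … N(v_i) < 1», rendered as LEMMA 17's hypothesis) and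
`|TQv|_{|k|=0} ≤ B` for all direction pairs. [cite: DurmagambetovFazilova2015NSMillennium, proof of Theorem 6 p.97 (sentences 2–3)] -/
def Smallness : Prop :=
  ∀ ν : ℝ, 0 < ν → ∀ q₀ : EuclideanSpace ℝ (Fin 3) → EuclideanSpace ℝ (Fin 3), IsDatum30 q₀ →
    ∀ C₀ : ℝ, 0 ≤ C₀ →
      ∃ M : ℝ, 1 ≤ M ∧ ∃ α : ℝ, α < 1 ∧ ∃ B : ℝ, 0 ≤ B ∧ C₀ * B < 1 ∧
        ∀ T : ℝ, 0 < T →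
          ∀ (u : ℝ → EuclideanSpace ℝ (Fin 3) → EuclideanSpace ℝ (Fin 3))
            (p : ℝ → EuclideanSpace ℝ (Fin 3) → ℝ), IsSolution ν T q₀ u p →
            ∀ t ∈ Icc 0 T, ∀ (i : Fin 3) (a : EuclideanSpace ℝ (Fin 3)),
              IsPotential (fun x => slice u t i a x / M) ∧
              (∃ S : ℝ, (∀ k, ‖ft (fun x => slice u t i a x / M) k‖ ≤ S) ∧
                l2 (fun x => slice u t i a x / M) + S < α) ∧
              ∀ d : EuclideanSpace ℝ (Fin 3), ‖d‖ ≤ 2 → ‖tq0 (fun x => slice u t i a x / M) d‖ ≤ B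

/-- **Step 7 — proof of Theorem 6, sentences 2–3 p.97 (the smallness inference)**: «To estimate the
velocity components, Lemma 22 can be used: v_i = q_i/(∫₀ᵀ‖q_x‖²_{L₂(R³)}dt + A₀ + 1), A₀ =
4/(ν^{1/3}(CC₀ + 1)^{2/3}). Using Lemmas (25)–(29) for v_i … we can obtain ‖A_i‖_TA < α < 1 where A_i is
the amplitude of potential v_i and N(v_i) < 1.» TYPED AS THE PRINTED INFERENCE `AprioriBlock →
Smallness` (the amplitude `A_i` (3) p.89, the norm `‖·‖_TA` (Def. 2 p.91) and the eigenvalue count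
`N` (7) p.90 are not typed; the consequent is rendered at the grain Lemma 17/(33) consume — see
`Smallness`). Flag: suspicious («we can obtain» — no derivation printed; the normalisation divides every
linear functional of `q_i` by `M`, but `M` is data-bounded while `‖q_i(t)‖_{L₂}` is only energy-bounded).
[cite: DurmagambetovFazilova2015NSMillennium, proof of Theorem 6 p.97 (sentences 2–3)] -/
def Step7_smallness : Prop :=
  AprioriBlock → Smallness

/-- **Statement 3, p.97 (just before Theorem 6), in the PROOF's form with its positivity hypothesis**:
«Let's consider the influence of the following large scale transformations in Navier-Stokes' equation
on K = ν^{1/2}/(ν^{1/2} − 4πCC₀^{1/2}), t′ = tA, v′ = v/A, F₀′ = F₀/A². Statement 3. Let A =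
4/(ν^{1/3}(CC₀+1)^{2/3}), then K ≤ 8/7. Proof. By the definitions C and C₀ we have K =
(ν/A)^{1/2}((ν/A)^{1/2} − 4πCC₀/A²)^{−1} = ν^{1/2}(ν^{1/2} − 4πCC₀/A^{3/2})^{−1} < 8/7.» Typed with the
PROOF's expression for `K` (referee lane 2 (P5): the displayed definition has `CC₀^{1/2}`, the proof
`CC₀/A^{3/2}` — the proof's form is the one argued) and with the hypothesis that the denominator is
positive (without it «K ≤ 8/7» is true by sign junk — vacuity trap), for non-negative constants `C`
(Lemma 28) and `C₀ = ∫₀ᵗ|F̃₁|²dτ` (51). Typist's flag: known-false pattern as real arithmetic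
(`A^{3/2} = 8/(ν^{1/2}(CC₀+1))` ⇒ `K = 1/(1 − (π/2)CC₀(CC₀+1))`; `ν = 1`, `CC₀ = 1/5` ⇒ `K ≈ 1.6 >
8/7`). CONSUMED by the proof of Theorem 6? The proof names the SAME constant `A₀ = A` in the
normalisation but attributes the smallness «‖A_i‖_TA < α < 1» to «Lemmas (25)–(29)» and never cites
Statement 3 or `K` — typed as an on-path CANDIDATE in print order (after Step 6, before Step 7), the
consumed/aside decision being the referee's; not a hypothesis of `claim_of_steps` (absorbed in `∃ M`).
[cite: DurmagambetovFazilova2015NSMillennium, Statement 3 and its proof p.97] -/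
def Statement3 : Prop :=
  ∀ ν C C₀ : ℝ, 0 < ν → 0 ≤ C → 0 ≤ C₀ →
    0 < Real.sqrt ν - 4 * Real.pi * C * C₀ /
        (4 / (ν ^ ((1 : ℝ) / 3) * (C * C₀ + 1) ^ ((2 : ℝ) / 3))) ^ ((3 : ℝ) / 2) →
      Real.sqrt ν /
          (Real.sqrt ν - 4 * Real.pi * C * C₀ /
            (4 / (ν ^ ((1 : ℝ) / 3) * (C * C₀ + 1) ^ ((2 : ℝ) / 3))) ^ ((3 : ℝ) / 2)) ≤ 8 / 7

/-- The CONSEQUENT of the smallness inference, T-DEPENDENT reading (referee lane 2 (P6): the bound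
(48) feeding the smallness carries `T/2`, so «uniform» can only mean «on `[0,T]`»): as `Smallness` but
`M`, `α`, `B` may depend on the horizon `T` (chosen after `T`, valid for all solutions on all
`[0,T']`, `T' ≤ T`). [cite: DurmagambetovFazilova2015NSMillennium, proof of Theorem 6 p.97 (sentences 2–3) with Lemma 22 (48) p.94] -/
def SmallnessT : Prop :=
  ∀ ν : ℝ, 0 < ν → ∀ q₀ : EuclideanSpace ℝ (Fin 3) → EuclideanSpace ℝ (Fin 3), IsDatum30 q₀ →
    ∀ C₀ : ℝ, 0 ≤ C₀ → ∀ T : ℝ, 0 < T →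
      ∃ M : ℝ, 1 ≤ M ∧ ∃ α : ℝ, α < 1 ∧ ∃ B : ℝ, 0 ≤ B ∧ C₀ * B < 1 ∧
        ∀ T' : ℝ, 0 < T' → T' ≤ T →
          ∀ (u : ℝ → EuclideanSpace ℝ (Fin 3) → EuclideanSpace ℝ (Fin 3))
            (p : ℝ → EuclideanSpace ℝ (Fin 3) → ℝ), IsSolution ν T' q₀ u p →
            ∀ t ∈ Icc 0 T', ∀ (i : Fin 3) (a : EuclideanSpace ℝ (Fin 3)),
              IsPotential (fun x => slice u t i a x / M) ∧
              (∃ S : ℝ, (∀ k, ‖ft (fun x => slice u t i a x / M) k‖ ≤ S) ∧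
                l2 (fun x => slice u t i a x / M) + S < α) ∧
              ∀ d : EuclideanSpace ℝ (Fin 3), ‖d‖ ≤ 2 → ‖tq0 (fun x => slice u t i a x / M) d‖ ≤ B

/-- **Step 7, T-DEPENDENT form**: the printed smallness inference p.97 read with horizon-dependent
constants, `AprioriBlock → SmallnessT`. [cite: DurmagambetovFazilova2015NSMillennium, proof of Theorem 6 p.97 (sentences 2–3)] -/
def Step7T_smallness : Prop :=
  AprioriBlock → SmallnessT

/-- **Step 8 — LEMMA 17 with (33), pp.92–93 (the pointwise reconstruction of the potential; NS-free,
abstract grain, TYPING-HYGIENE 13)**: «Lemma 17. Let q ∈ ℜ ∩ L₂(R³) and ‖q‖_{L₂} + max_k|q̃| < α < 1.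
Then, Ψ±|_{x=0} > 1 − α/(1 − α) (32), |q||_{x=0} ≤ Σ_{i=1}^∞ (C₀|TQq||_{|k|=0})^i (33). To prove this
result, one should calculate Ψ±|_{x=0}.» Typed: there is a constant `C₀ ≥ 0` (printed unspecified,
the same symbol in (24), (29), (30)) such that for every `α < 1` and every admissible potential `q`
(smooth, `L¹ ∩ L²` — a subclass of `ℜ ∩ L₂`) with `‖q‖_{L₂} + S < α` for an upper bound `S` of
`|q̃|`, and every bound `B ≥ 0` of `|TQq|_{|k|=0}` over the direction pairs with `C₀B < 1`, the value at
the origin obeys `|q(0)| ≤ Σ_{i≥1}(C₀B)^i = C₀B/(1 − C₀B)` (monotone in the printed right-hand side;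
(32), about the untyped Jost solutions `Ψ±`, is not typed). Typist's flag: known-false pattern (even
potentials: `q̃` even ⇒ the principal value `TQq|_{|k|=0}` vanishes ⇒ (33) forces `q(0) = 0`).
[cite: DurmagambetovFazilova2015NSMillennium, Lemma 17 (32)–(33) pp.92–93] -/
def Step8_reconstruction33 : Prop :=
  ∃ C₀ : ℝ, 0 ≤ C₀ ∧
    ∀ α : ℝ, α < 1 → ∀ q : EuclideanSpace ℝ (Fin 3) → ℝ, IsPotential q →
      ∀ S : ℝ, (∀ k, ‖ft q k‖ ≤ S) → l2 q + S < α →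
        ∀ B : ℝ, 0 ≤ B → (∀ d : EuclideanSpace ℝ (Fin 3), ‖d‖ ≤ 2 → ‖tq0 q d‖ ≤ B) → C₀ * B < 1 →
          |q 0| ≤ C₀ * B / (1 - C₀ * B)

/-! ## Composition (pure logic + the tree's uniqueness theorem in the class) — PROVED -/

/-- **The a-priori sup bound the proof of Theorem 6 asserts** («uniform time estimations for the
maximum values of the velocity components», p.97), DERIVED in the kernel from Steps 3–8: one constant
per `(ν, q₀)` bounding `Σ_i |q_i(x,t)|` for every solution on every horizon.
[cite: DurmagambetovFazilova2015NSMillennium, proof of Theorem 6 p.97] -/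
theorem aprioriSup_of_steps (h3 : Step3_energy39) (h4 : Step4_fourierSup48) (h5 : Step5_moments46)
    (h6 : Step6_shellBound55) (h7 : Step7_smallness) (h8 : Step8_reconstruction33) :
    ∀ ν : ℝ, 0 < ν → ∀ q₀ : EuclideanSpace ℝ (Fin 3) → EuclideanSpace ℝ (Fin 3), IsDatum30 q₀ →
      ∃ C : ℝ, ∀ T : ℝ, 0 < T →
        ∀ (u : ℝ → EuclideanSpace ℝ (Fin 3) → EuclideanSpace ℝ (Fin 3)) (p : ℝ → EuclideanSpace ℝ (Fin 3) → ℝ),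
          IsSolution ν T q₀ u p → ∀ t ∈ Icc 0 T, ∀ x, ∑ i : Fin 3, |u t x i| ≤ C := by
  intro ν hν q₀ hq₀
  obtain ⟨C₀, hC₀, h33⟩ := h8
  obtain ⟨M, hM, α, hα, B, hB, hCB, hsmall⟩ := h7 ⟨h3, h4, h5, h6⟩ ν hν q₀ hq₀ C₀ hC₀
  set K : ℝ := C₀ * B / (1 - C₀ * B) with hK
  refine ⟨3 * (M * K), fun T hT u p hsol t ht x => ?_⟩
  have hcomp : ∀ i : Fin 3, |u t x i| ≤ M * K := by
    intro i
    obtain ⟨hpot, ⟨S, hS, hsm⟩, htq⟩ := hsmall T hT u p hsol t ht i x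
    have hv := h33 α hα (fun y => slice u t i x y / M) hpot S hS hsm B hB htq hCB
    have hMpos : 0 < M := lt_of_lt_of_le one_pos hM
    have hv' : |u t x i| / M ≤ K := by
      simpa [slice, abs_div, abs_of_pos hMpos] using hv
    rwa [div_le_iff₀ hMpos, mul_comm] at hv'
  calc ∑ i : Fin 3, |u t x i| ≤ ∑ _i : Fin 3, M * K := Finset.sum_le_sum fun i _ => hcomp i
    _ = 3 * (M * K) := by simp

/-- **KERNEL COMPOSITION: Step 1 → … → Step 8 → ClaimedTheorem.** The a-priori bound
(`aprioriSup_of_steps`, Steps 3–8) feeds the continuation Step 2 together with the local existence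
Step 1; uniqueness on `[0,T]` is the tree's `IsClassicalNSSolutionOn.eq_of_hasBoundedSobolevNormsOn`
(Majda–Bertozzi Cor. 3.1). Pure logic otherwise; nothing asserted.
[cite: DurmagambetovFazilova2015NSMillennium, Theorem 6 and its proof p.97] -/
theorem claim_of_steps (h1 : Step1_localExistence) (h2 : Step2_continuation) (h3 : Step3_energy39)
    (h4 : Step4_fourierSup48) (h5 : Step5_moments46) (h6 : Step6_shellBound55) (h7 : Step7_smallness)
    (h8 : Step8_reconstruction33) : ClaimedTheorem := by
  intro ν hν q₀ hq₀
  obtain ⟨C, hC⟩ := aprioriSup_of_steps h3 h4 h5 h6 h7 h8 ν hν q₀ hq₀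
  refine ⟨C, fun T hT => ⟨h2 ν hν q₀ hq₀ (h1 ν hν q₀ hq₀) C hC T hT, ?_, fun u p hsol => hC T hT u p hsol⟩⟩
  intro u p u' p' hu hu' t ht
  have h0 : u' 0 = u 0 := by rw [hu'.initial, hu.initial]
  exact hu'.sol.isClassical.eq_of_hasBoundedSobolevNormsOn hu.sol.isClassical hν.le hT hu'.sol.sobolev
    hu.sol.sobolev h0 ht

/-- **T-dependent a-priori bound from Steps 3–6, 7T, 8**: for every horizon one constant bounding
`Σ_i|q_i|` for every solution on every `[0,T']`, `T' ≤ T`. [cite: DurmagambetovFazilova2015NSMillennium, proof of Theorem 6 p.97] -/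
theorem aprioriSupT_of_steps (h3 : Step3_energy39) (h4 : Step4_fourierSup48) (h5 : Step5_moments46)
    (h6 : Step6_shellBound55) (h7 : Step7T_smallness) (h8 : Step8_reconstruction33) :
    ∀ ν : ℝ, 0 < ν → ∀ q₀ : EuclideanSpace ℝ (Fin 3) → EuclideanSpace ℝ (Fin 3), IsDatum30 q₀ →
      ∀ T : ℝ, 0 < T → ∃ C : ℝ, ∀ T' : ℝ, 0 < T' → T' ≤ T →
        ∀ (u : ℝ → EuclideanSpace ℝ (Fin 3) → EuclideanSpace ℝ (Fin 3)) (p : ℝ → EuclideanSpace ℝ (Fin 3) → ℝ),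
          IsSolution ν T' q₀ u p → ∀ t ∈ Icc 0 T', ∀ x, ∑ i : Fin 3, |u t x i| ≤ C := by
  intro ν hν q₀ hq₀ T hT
  obtain ⟨C₀, hC₀, h33⟩ := h8
  obtain ⟨M, hM, α, hα, B, hB, hCB, hsmall⟩ := h7 ⟨h3, h4, h5, h6⟩ ν hν q₀ hq₀ C₀ hC₀ T hT
  set K : ℝ := C₀ * B / (1 - C₀ * B) with hK
  refine ⟨3 * (M * K), fun T' hT' hT'T u p hsol t ht x => ?_⟩
  have hcomp : ∀ i : Fin 3, |u t x i| ≤ M * K := by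
    intro i
    obtain ⟨hpot, ⟨S, hS, hsm⟩, htq⟩ := hsmall T' hT' hT'T u p hsol t ht i x
    have hv := h33 α hα (fun y => slice u t i x y / M) hpot S hS hsm B hB htq hCB
    have hMpos : 0 < M := lt_of_lt_of_le one_pos hM
    have hv' : |u t x i| / M ≤ K := by
      simpa [slice, abs_div, abs_of_pos hMpos] using hv
    rwa [div_le_iff₀ hMpos, mul_comm] at hv'
  calc ∑ i : Fin 3, |u t x i| ≤ ∑ _i : Fin 3, M * K := Finset.sum_le_sum fun i _ => hcomp i
    _ = 3 * (M * K) := by simp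

/-- **KERNEL COMPOSITION, T-dependent reading: Step 1 → Step 2T → Steps 3–6 → Step 7T → Step 8 →
ClaimedTheoremT.** [cite: DurmagambetovFazilova2015NSMillennium, Theorem 6 and its proof p.97] -/
theorem claimT_of_steps (h1 : Step1_localExistence) (h2 : Step2T_continuation) (h3 : Step3_energy39)
    (h4 : Step4_fourierSup48) (h5 : Step5_moments46) (h6 : Step6_shellBound55) (h7 : Step7T_smallness)
    (h8 : Step8_reconstruction33) : ClaimedTheoremT := by
  intro ν hν q₀ hq₀ T hT
  have hC := aprioriSupT_of_steps h3 h4 h5 h6 h7 h8 ν hν q₀ hq₀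
  obtain ⟨C, hCT⟩ := hC T hT
  refine ⟨C, h2 ν hν q₀ hq₀ (h1 ν hν q₀ hq₀) hC T hT, ?_, fun u p hsol => hCT T hT le_rfl u p hsol⟩
  intro u p u' p' hu hu' t ht
  have h0 : u' 0 = u 0 := by rw [hu'.initial, hu.initial]
  exact hu'.sol.isClassical.eq_of_hasBoundedSobolevNormsOn hu.sol.isClassical hν.le hT hu'.sol.sobolev
    hu.sol.sobolev h0 ht

/-! ## Discharge of `ClayDelta30` (ns-claims-lit-4 g4): the per-horizon ⇒ global patching is a theorem -/

/-- **`ClayDelta30` holds.** Per-horizon solutions of the class on every `[0,T]`, unique on each `[0,T]`,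
patch to ONE global solution of the class: the generic patching lemma
`IsClassicalNSSolutionOn.exists_Ici_of_forall_Icc_of_unique` (`Literature/Analysis/FluidPDE/ClassicalNSHorizonPatching.lean`)
with the class `Q T u p := IsSolution ν T u₀ u p`; uniqueness across two horizons is the per-horizon
uniqueness on the shorter slab `[0,t]` (restriction `IsClassicalNSSolutionOn.mono` /
`HasBoundedSobolevNormsOn.mono`); the Sobolev bounds of the patched solution on `[0,T]` are those of the
member it coincides with there. The datum hypothesis `IsDatum30` is not used (same argument as C25's
`Ruzmaikina2008.clayDelta_holds`). [cite: FeffermanClay2006, statement (A)] [cite: RobinsonRodrigoSadowskiCUP2016, §8.1] -/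
theorem clayDelta30_holds : ClayDelta30 := by
  intro ν _hν u₀ _hu₀ hex huniq
  have huniq' : ∀ (T₁ T₂ : ℝ) (U₁ : ℝ → EuclideanSpace ℝ (Fin 3) → EuclideanSpace ℝ (Fin 3))
      (P₁ : ℝ → EuclideanSpace ℝ (Fin 3) → ℝ) (U₂ : ℝ → EuclideanSpace ℝ (Fin 3) → EuclideanSpace ℝ (Fin 3))
      (P₂ : ℝ → EuclideanSpace ℝ (Fin 3) → ℝ),
      IsSolution ν T₁ u₀ U₁ P₁ → IsSolution ν T₂ u₀ U₂ P₂ → ∀ t ∈ Icc 0 T₁, t ≤ T₂ → U₁ t = U₂ t := by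
    intro T₁ T₂ U₁ P₁ U₂ P₂ h₁ h₂ t ht htT₂
    rcases ht.1.eq_or_lt with h00 | ht0
    · subst h00
      rw [h₁.initial, h₂.initial]
    · have h₁' : IsSolution ν t u₀ U₁ P₁ :=
        ⟨⟨h₁.sol.isClassical.mono (Icc_subset_Icc_right ht.2) (uniqueDiffOn_Icc ht0),
          h₁.sol.sobolev.mono (Icc_subset_Icc_right ht.2)⟩, h₁.initial⟩
      have h₂' : IsSolution ν t u₀ U₂ P₂ :=
        ⟨⟨h₂.sol.isClassical.mono (Icc_subset_Icc_right htT₂) (uniqueDiffOn_Icc ht0),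
          h₂.sol.sobolev.mono (Icc_subset_Icc_right htT₂)⟩, h₂.initial⟩
      exact huniq t ht0 U₂ P₂ U₁ P₁ h₂' h₁' t ⟨ht0.le, le_rfl⟩
  obtain ⟨u, p, hcl, h0, -, hloc⟩ := IsClassicalNSSolutionOn.exists_Ici_of_forall_Icc_of_unique
    (fun T U P => IsSolution ν T u₀ U P) (fun T U P h => ⟨h.sol.isClassical, h.initial⟩) hex huniq'
  refine ⟨u, p, hcl, h0, fun T => ?_⟩
  obtain ⟨T', U, P, hTT', hUP, hu, -⟩ := hloc (max T 1) (lt_of_lt_of_le one_pos (le_max_right _ _))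
  intro n
  obtain ⟨C, hC⟩ := hUP.sol.sobolev n
  refine ⟨C, fun t ht => ?_⟩
  have ht' : t ∈ Icc 0 (max T 1) := ⟨ht.1, ht.2.trans (le_max_left _ _)⟩
  rw [hu t ht']
  exact hC t ⟨ht.1, ht'.2.trans hTT'⟩

/-- **Clay (A) from the horizon form of the claimed theorem, the bookkeeping discharged**:
`ClaimedTheoremT → clayR3.Regularity` (`clayA_of_claimed_of_delta` with `clayDelta30_holds`).
[cite: FeffermanClay2006, statement (A)] -/
theorem clayA_of_claimedT (h : ClaimedTheoremT) : ClayVariants.clayR3.Regularity :=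
  clayA_of_claimed_of_delta clayDelta30_holds h

/-- **Clay (A) from the claimed theorem (time-uniform form), the bookkeeping discharged**:
`ClaimedTheorem → clayR3.Regularity` (via `claimedT_of_claimed`). [cite: FeffermanClay2006, statement (A)] -/
theorem clayA_of_claimed (h : ClaimedTheorem) : ClayVariants.clayR3.Regularity :=
  clayA_of_claimedT (claimedT_of_claimed h)


/-! ## Discharge of Step 2 (ns-claims-lit-4 g5): «uniform estimates allow us to extend the local
existence and uniqueness theorem» is a THEOREM in the rendered class — Leray's blow-up alternative -/

/-- `‖x‖ ≤ Σᵢ |xᵢ|` on `ℝ³` (Euclidean norm versus the `ℓ¹` sum the paper's bound controls). [folklore] -/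
private theorem norm_le_sum_abs (x : EuclideanSpace ℝ (Fin 3)) : ‖x‖ ≤ ∑ i : Fin 3, |x i| := by
  have h0 : 0 ≤ ∑ i : Fin 3, |x i| := Finset.sum_nonneg fun i _ => abs_nonneg _
  rw [EuclideanSpace.norm_eq, Real.sqrt_le_left h0]
  calc ∑ i : Fin 3, ‖x i‖ ^ 2 = ∑ i : Fin 3, |x i| ^ 2 :=
        Finset.sum_congr rfl fun i _ => by rw [Real.norm_eq_abs]
    _ ≤ (∑ i : Fin 3, |x i|) ^ 2 := Finset.sum_sq_le_sq_sum_of_nonneg fun i _ => abs_nonneg (x i)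

/-- A finite-energy classical solution on a closed slab `[0, T]`, `T > 0`, from a datum of the class is a
solution of the rendered class `IsSolution` (all Sobolev norms bounded: Tao 2013 Cor. 11.1, tree theorem
`IsClassicalNSSolutionOn.hasBoundedSobolevNormsOn_of_sobolevDatum_unforced`).
[cite: Tao2011, Cor. 11.1 + Thm. 5.4 (iv) (arXiv Cor. 68, Thm. 31 (iv))] -/
theorem isSolution_of_finiteEnergy {ν T : ℝ} (hν : 0 < ν) (hT : 0 < T)
    {q₀ : EuclideanSpace ℝ (Fin 3) → EuclideanSpace ℝ (Fin 3)} (hq₀ : IsDatum30 q₀)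
    {u : ℝ → EuclideanSpace ℝ (Fin 3) → EuclideanSpace ℝ (Fin 3)} {p : ℝ → EuclideanSpace ℝ (Fin 3) → ℝ}
    (hcl : IsClassicalNSSolutionOn (Icc 0 T) ν 0 u p) (hu0 : u 0 = q₀)
    (hE : ∃ A : ℝ≥0∞, A < ⊤ ∧ ∀ t ∈ Icc 0 T, ∫⁻ x, ‖u t x‖ₑ ^ 2 ≤ A) : IsSolution ν T q₀ u p := by
  have hE' : ∃ C : ℝ≥0, ∀ t ∈ Icc 0 T, ∫⁻ x, ‖u t x‖ₑ ^ 2 ≤ C := by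
    obtain ⟨A, hA, hb⟩ := hE
    exact ⟨A.toNNReal, fun t ht => (hb t ht).trans (ENNReal.coe_toNNReal hA.ne).ge⟩
  have h₀ : ∀ m : ℕ, ∫⁻ x, ‖iteratedFDeriv ℝ m (u 0) x‖ₑ ^ 2 < ⊤ := fun m => by
    rw [hu0]; exact hq₀.1.2.2 m
  exact ⟨⟨hcl, hcl.hasBoundedSobolevNormsOn_of_sobolevDatum_unforced hν hT hE' h₀⟩, hu0⟩

/-- **Leray's alternative in the rendered class**: for `ν > 0` and a datum of the class, EITHER every
closed slab `[0, T]` carries a solution of the class `IsSolution`, OR some solution of the class exists on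
every `[0, T']`, `T' < T*`, along ONE classical field on `[0, T*)` whose velocity is unbounded there
(tree theorem `Literature.Analysis.FluidPDE.finiteEnergy_classical_dichotomy`). [cite: Leray1934, §33] [cite: RobinsonRodrigoSadowskiCUP2016, Thm 8.17 with the proof of Thm 12.3] -/
theorem isSolution_forall_or_supBlowup {ν : ℝ} (hν : 0 < ν)
    {q₀ : EuclideanSpace ℝ (Fin 3) → EuclideanSpace ℝ (Fin 3)} (hq₀ : IsDatum30 q₀) :
    (∀ T : ℝ, 0 < T →
      ∃ (u : ℝ → EuclideanSpace ℝ (Fin 3) → EuclideanSpace ℝ (Fin 3)) (p : ℝ → EuclideanSpace ℝ (Fin 3) → ℝ),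
        IsSolution ν T q₀ u p) ∨
    ∃ Ts : ℝ, 0 < Ts ∧
      ∃ (u : ℝ → EuclideanSpace ℝ (Fin 3) → EuclideanSpace ℝ (Fin 3)) (p : ℝ → EuclideanSpace ℝ (Fin 3) → ℝ),
        (∀ T' : ℝ, 0 < T' → T' < Ts → IsSolution ν T' q₀ u p) ∧
        ∀ M : ℝ, ∃ t ∈ Ico 0 Ts, ∃ x, M < ‖u t x‖ := by
  have hq := hq₀
  obtain ⟨⟨hsm, hdiv, hH⟩, -⟩ := hq
  rcases finiteEnergy_classical_dichotomy hν hsm hdiv hH with hall | ⟨Ts, hTs, u, p, hcl, hu0, hE, hb, -⟩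
  · refine Or.inl fun T hT => ?_
    obtain ⟨u, p, hcl, hu0, hE⟩ := hall T hT
    exact ⟨u, p, isSolution_of_finiteEnergy hν hT hq₀ hcl hu0 hE⟩
  · refine Or.inr ⟨Ts, hTs, u, p, fun T' hT' hT'Ts => ?_, hb⟩
    refine isSolution_of_finiteEnergy hν hT' hq₀
      (hcl.mono (Icc_subset_Ico_right hT'Ts) (uniqueDiffOn_Icc hT')) hu0 ?_
    obtain ⟨A, hA, hb'⟩ := hE
    exact ⟨A, hA, fun t ht => hb' t ⟨ht.1, ht.2.trans_lt hT'Ts⟩⟩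

/-- **Step 2 holds** (proof of Theorem 6, sentence 1 p.97: «uniform estimates allow us to extend the local
existence and uniqueness theorem over the interval in which they are valid»): in the rendered class, ONE
constant bounding `Σᵢ|qᵢ|` for every solution on every `[0,T]` yields a solution on every `[0,T]` — by
Leray's alternative (`isSolution_forall_or_supBlowup`): the blow-up branch carries solutions of the class on
every `[0,T']`, `T' < T*`, along a field whose velocity is unbounded on `[0,T*)`, contradicting the bound
(`‖q‖ ≤ Σᵢ|qᵢ| ≤ C`). The local-existence hypothesis is not even used.
[cite: DurmagambetovFazilova2015NSMillennium, proof of Theorem 6 p.97 (sentence 1)] [cite: Leray1934, §33] -/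
theorem step2_continuation_holds : Step2_continuation := by
  intro ν hν q₀ hq₀ _ C hC T hT
  rcases isSolution_forall_or_supBlowup hν hq₀ with hall | ⟨Ts, hTs, u, p, hsol, hb⟩
  · exact hall T hT
  · exfalso
    obtain ⟨t, ht, x, hMx⟩ := hb C
    set T' : ℝ := (t + Ts) / 2 with hT'
    have hT'pos : 0 < T' := by rw [hT']; linarith [ht.1, ht.2]
    have htT' : t ≤ T' := by rw [hT']; linarith [ht.2]
    have hT'Ts : T' < Ts := by rw [hT']; linarith [ht.2]
    have h1 := hC T' hT'pos u p (hsol T' hT'pos hT'Ts) t ⟨ht.1, htT'⟩ x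
    exact absurd ((norm_le_sum_abs (u t x)).trans h1) (not_le.2 hMx)

/-- **Step 2, T-dependent form, holds** (same printed sentence, horizon-dependent constants `C_T`): the
blow-up branch is excluded by the constant of the horizon `T = T*`.
[cite: DurmagambetovFazilova2015NSMillennium, proof of Theorem 6 p.97 (sentence 1)] [cite: Leray1934, §33] -/
theorem step2T_continuation_holds : Step2T_continuation := by
  intro ν hν q₀ hq₀ _ hC T hT
  rcases isSolution_forall_or_supBlowup hν hq₀ with hall | ⟨Ts, hTs, u, p, hsol, hb⟩
  · exact hall T hT
  · exfalso
    obtain ⟨C, hCT⟩ := hC Ts hTs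
    obtain ⟨t, ht, x, hMx⟩ := hb C
    set T' : ℝ := (t + Ts) / 2 with hT'
    have hT'pos : 0 < T' := by rw [hT']; linarith [ht.1, ht.2]
    have htT' : t ≤ T' := by rw [hT']; linarith [ht.2]
    have hT'Ts : T' < Ts := by rw [hT']; linarith [ht.2]
    have h1 := hCT T' hT'pos hT'Ts.le u p (hsol T' hT'pos hT'Ts) t ⟨ht.1, htT'⟩ x
    exact absurd ((norm_le_sum_abs (u t x)).trans h1) (not_le.2 hMx)

/-- **COMPOSITION with Step 2 discharged**: Theorem 6 (time-uniform form) from Steps 1, 3–8 only.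
[cite: DurmagambetovFazilova2015NSMillennium, Theorem 6 p.97] -/
theorem claim_of_steps' (h1 : Step1_localExistence) (h3 : Step3_energy39) (h4 : Step4_fourierSup48)
    (h5 : Step5_moments46) (h6 : Step6_shellBound55) (h7 : Step7_smallness) (h8 : Step8_reconstruction33) :
    ClaimedTheorem :=
  claim_of_steps h1 step2_continuation_holds h3 h4 h5 h6 h7 h8

/-! ## Step 3 discharged (rev 3, lit-4 g5): (39) is Leray's energy equality in the rendered class -/

/-- **Step 3 — Lemma 18, (39) p.93 — PROVED in the rendered class.** For every solution of the class
(`IsSolution ν T q₀ u p`: classical on `[0,T] × ℝ³` with all `L²` Sobolev seminorms bounded, so in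
particular of finite energy) and `t ∈ [0,T]`: `‖q(t)‖² + 2ν∫₀ᵗ‖q_x‖² ≤ ‖q₀‖²` — indeed with equality,
by Leray's energy equality for finite-energy classical solutions (tree theorem
`IsClassicalNSSolutionOn.integral_norm_sq_add_dissipation_eq`, Leray 1934 (3.4) / Tao 2013 Lemma 8.1,
whose two real integrals are token-for-token this file's `energy` and `dissipation`). The datum
hypothesis `IsDatum30 q₀` is not used.
[cite: DurmagambetovFazilova2015NSMillennium, Lemma 18 (39) p.93] [cite: Leray1934, §17 (3.4) p. 220] -/
theorem step3_energy39_holds : Step3_energy39 := by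
  intro ν T q₀ u p hν hT _ hsol t ht
  have hcl := hsol.sol.isClassical
  -- finite energy on `[0,T]` from the `H⁰` seminorm bound of the class
  obtain ⟨C₀, hC₀⟩ := hsol.sol.sobolev 0
  have hfe : ∃ A : ℝ≥0∞, A < ⊤ ∧ ∀ s ∈ Icc 0 T, ∫⁻ x, ‖u s x‖ₑ ^ 2 ≤ A := by
    refine ⟨C₀, ENNReal.coe_lt_top, fun s hs => le_of_eq_of_le (lintegral_congr fun x => ?_) (hC₀ s hs)⟩
    rw [← ofReal_norm, ← ofReal_norm (iteratedFDeriv ℝ 0 (u s) x), norm_iteratedFDeriv_zero]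
  have hE := hcl.integral_norm_sq_add_dissipation_eq hν hT hfe le_rfl ht.1 ht.2
  unfold energy dissipation
  exact hE.le

/-- **COMPOSITION with Steps 2 AND 3 discharged**: Theorem 6 (time-uniform form) from Steps 1, 4–8.
(Step 1 = Theorem 5 p.93 is discharged on the Summits side, `SoloSalvageDurmagambetov2015.lean`.)
[cite: DurmagambetovFazilova2015NSMillennium, Theorem 6 p.97] -/
theorem claim_of_steps'' (h1 : Step1_localExistence) (h4 : Step4_fourierSup48)
    (h5 : Step5_moments46) (h6 : Step6_shellBound55) (h7 : Step7_smallness) (h8 : Step8_reconstruction33) :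
    ClaimedTheorem :=
  claim_of_steps h1 step2_continuation_holds step3_energy39_holds h4 h5 h6 h7 h8

end Literature.Claims.NS.Durmagambetov2015

end

-- WHAT THIS IS NOT: not a claim about NS regularity or blow-up; not a claim about any author beyond the typed locator.
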